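import Literature.Dynamics.Homogeneous.OrthogonalGroupOrbitClosuresK3Plane
import Literature.Algebra.EuclideanLattices.IntegerKernelSpan
import HarnessLib

/-!
# Fixed spaces of families of integer matrices are rational: the rationality step of the
# Borel-density exclusions in Verbitsky's orbit-closure trichotomy (erratum §2.3)

Topic `Literature/Dynamics/Homogeneous`; theorems only (no new notion, no named fact — D-0026), on
top of `OrthogonalGroupOrbitClosuresK3Plane` (the plane `P_x = ⟨Re x, Im x⟩` of a K3 period vector)
and of the support file `Literature/Algebra/EuclideanLattices/IntegerKernelSpan` (the real kernel of
an integer matrix is the real span of its integer kernel). In the Ratner-theoretic proof of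
`Literature.Dynamics.Homogeneous.Verbitsky2017_orbitClosure_trichotomy_K3`
[Verbitsky2017ErgodicErratum, §2.3] the intermediate Ratner groups `S = SO(P_x^⊥)°` and
`S = SO(ℓ^⊥)°` (`ℓ ⊂ P_x` a line) carry the lattice `Δ = Γ ∩ S` of INTEGER matrices; Borel's
density theorem [Morris2005Ratner, Prop. 4.7.1] puts the unipotent elements of `S` into the Zariski
closure of `Δ`, so the common fixed space of `Δ` lies in that of the unipotents — `P_x` by
`k3_forall_isotropicWedge_apply_eq_zero_iff` / `SkewPlane.unipotent_apply_eq_self_iff`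
(`…Unipotents`, `…K3Plane`) — while `Δ ⊆ S` fixes `P_x` (resp. `ℓ`) pointwise. This file proves
the purely arithmetic conclusion of that situation, in the vocabulary of the fact:

* `mem_span_latticeFixed_of_forall_mulVec_eq` (any finite index type, any family
  `Δ ⊆ M_n(ℤ)`): the common real fixed space `{y | g y = y ∀ g ∈ Δ}` is spanned over `ℝ` by its
  LATTICE points (stack the integer matrices `g − 1` and apply `realKer_eq_span_intKer`; Hamel
  basis of `ℝ/ℚ` and clearing denominators);
* `k3_isRationalPlane_of_fixedSpace_eq_plane`: if the fixed space of `Δ` is exactly `P_x`, then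
  `P_x` is RATIONAL (`Re x`, `Im x` are real combinations of two lattice vectors — the predicate
  `IsRationalPlane` of the fact), i.e. `x` is in case (i), contradicting (ii)/(iii);
* `k3_exists_latticeVector_inPlane_of_fixed`: if the fixed space of `Δ` lies in `P_x` and contains a
  non-zero vector, then `P_x` contains a non-zero lattice vector fixed by `Δ` (the predicate
  `InPlane v x`), contradicting the hypothesis of case (ii) and pinning `ℓ = ℝv` in case (iii).

Not here: Borel density itself, Ratner's theorem, the Lie correspondence (not in Mathlib), and the
exclusion of `S = SO(P_x^⊥)°·SO(P_x)` (which needs the commutant, `k3_forall_commute_isotropicWedge_iff`,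
and a characteristic-polynomial rationality argument).

## References

* [Verbitsky2017ErgodicErratum] M. Verbitsky, Ergodic complex structures on hyperkähler manifolds:
  an erratum, arXiv:1708.05802 (2017), §2.3 (proof of the Theorem: the intermediate groups and the
  three cases (i)–(iii)), §2.2.
* [Morris2005Ratner] D. W. Morris, Ratner's Theorems on Unipotent Flows, Univ. of Chicago Press
  2005, Prop. 4.7.1 (Borel density theorem), Rem. 1.1.19 (the finite-volume orbit `xS` and the
  lattice `Γ ∩ S`).
-/

noncomputable section

namespace Literature.Dynamics.Homogeneous

open Module
open scoped Matrix
open Literature.AlgebraicGeometry Literature.AlgebraicGeometry.Surfaces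
open Literature.Algebra.EuclideanLattices

/-! ### Fixed spaces of families of integer matrices are rational -/

section FixedSpace

variable {n : Type*} [Fintype n] [DecidableEq n]

/-- **The common fixed space of a family of integer matrices is spanned by its lattice points**:
if `g y = y` for all `g ∈ Δ ⊆ M_n(ℤ)` (`y ∈ ℝⁿ`), then `y` is a real linear combination of
INTEGER vectors `v` with `g v = v` for all `g ∈ Δ` (the real kernel of the stacked integer matrix
`(g − 1)_{g ∈ Δ}` is the real span of its integer kernel,
`IntegerKernelBasis.realKer_eq_span_intKer`, via a Hamel basis of `ℝ/ℚ`). [folklore] -/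
theorem mem_span_latticeFixed_of_forall_mulVec_eq (Δ : Set (Matrix n n ℤ)) {y : n → ℝ}
    (hy : ∀ g ∈ Δ, (g.map (Int.cast : ℤ → ℝ)) *ᵥ y = y) :
    y ∈ Submodule.span ℝ {u : n → ℝ | ∃ v : n → ℤ, (∀ g ∈ Δ, g *ᵥ v = v) ∧ u = fun i => (v i : ℝ)} := by
  classical
  -- stack the matrices `g − 1`, `g ∈ Δ`
  let D : Matrix (Δ × n) n ℤ := fun p j => (p.1.1 - 1) p.2 j
  have hD : ∀ (w : n → ℤ), D *ᵥ w = 0 ↔ ∀ g ∈ Δ, g *ᵥ w = w := by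
    intro w
    constructor
    · intro h g hg
      funext i
      have h0 := congrFun h (⟨g, hg⟩, i)
      simp only [Matrix.mulVec, dotProduct, Pi.zero_apply, D, Matrix.sub_apply, sub_mul,
        Finset.sum_sub_distrib, Matrix.one_apply, ite_mul, one_mul, zero_mul,
        Finset.sum_ite_eq, Finset.mem_univ, if_true] at h0
      simp only [Matrix.mulVec, dotProduct]
      exact sub_eq_zero.1 h0
    · intro h
      funext p
      obtain ⟨⟨g, hg⟩, i⟩ := p
      have h0 := congrFun (h g hg) i
      simp only [Matrix.mulVec, dotProduct] at h0
      simp only [Matrix.mulVec, dotProduct, Pi.zero_apply, D, Matrix.sub_apply, sub_mul,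
        Finset.sum_sub_distrib, Matrix.one_apply, ite_mul, one_mul, zero_mul,
        Finset.sum_ite_eq, Finset.mem_univ, if_true]
      exact sub_eq_zero.2 h0
  have hDR : (D.map (Int.cast : ℤ → ℝ)) *ᵥ y = 0 := by
    funext p
    obtain ⟨⟨g, hg⟩, i⟩ := p
    have h0 := congrFun (hy g hg) i
    simp only [Matrix.mulVec, dotProduct, Matrix.map_apply] at h0
    simp only [Matrix.mulVec, dotProduct, Pi.zero_apply, Matrix.map_apply, D, Matrix.sub_apply,
      Int.cast_sub, sub_mul, Finset.sum_sub_distrib, Matrix.one_apply, Int.cast_ite, Int.cast_one,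
      Int.cast_zero, ite_mul, one_mul, zero_mul, Finset.sum_ite_eq, Finset.mem_univ, if_true]
    exact sub_eq_zero.2 h0
  have hker : y ∈ LinearMap.ker (Matrix.mulVecLin (D.map (Int.cast : ℤ → ℝ))) := by
    rw [LinearMap.mem_ker, Matrix.mulVecLin_apply, hDR]
  rw [IntegerKernelBasis.realKer_eq_span_intKer] at hker
  refine (Submodule.span_mono ?_) hker
  rintro _ ⟨w, hw, rfl⟩
  exact ⟨w, (hD w).1 hw, rfl⟩

end FixedSpace

/-! ### Rationality of the plane / of a line from the fixed space (K3 vocabulary) -/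

section K3Rational

/-- **Fixed space = the plane ⇒ the plane is rational.** Let `x ∈ D` and `Δ ⊆ SO(Λ_{K3})` (any
family of integer matrices). If the common fixed vectors of `Δ` in `Λ ⊗ ℝ` are exactly the plane
`P_x = ⟨Re x, Im x⟩`, then `P_x` is a RATIONAL plane in the sense of the fact
`Verbitsky2017_orbitClosure_trichotomy_K3` (`Re x`, `Im x` are real combinations of two lattice
vectors). This is how Borel's density theorem excludes the Ratner group `S = SO(P_x^⊥)°` for an
irrational plane: `Δ = Γ ∩ S` fixes `P_x`, and Borel density puts the unipotents of `S` in the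
Zariski closure of `Δ`, whose fixed vectors are `P_x` (`k3_forall_isotropicWedge_apply_eq_zero_iff`,
`SkewPlane.unipotent_apply_eq_self_iff`). [folklore] -/
theorem k3_isRationalPlane_of_fixedSpace_eq_plane {x : K3Index → ℂ} (hx : x ∈ k3PeriodDomain)
    (Δ : Set (Matrix K3Index K3Index ℤ))
    (hsub : ∀ y : K3Index → ℝ, (∀ g ∈ Δ, (g.map (Int.cast : ℤ → ℝ)) *ᵥ y = y) →
      ∃ a b : ℝ, y = a • (fun i => (x i).re) + b • (fun i => (x i).im))
    (hre : ∀ g ∈ Δ, (g.map (Int.cast : ℤ → ℝ)) *ᵥ (fun i => (x i).re) = fun i => (x i).re)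
    (him : ∀ g ∈ Δ, (g.map (Int.cast : ℤ → ℝ)) *ᵥ (fun i => (x i).im) = fun i => (x i).im) :
    ∃ (u w : K3Index → ℤ) (a b c d : ℝ), ∀ i,
      (x i).re = a * u i + b * w i ∧ (x i).im = c * u i + d * w i := by
  classical
  set R : K3Index → ℝ := fun i => (x i).re with hR
  set I : K3Index → ℝ := fun i => (x i).im with hI
  set F : Set (K3Index → ℝ) :=
    {u | ∃ v : K3Index → ℤ, (∀ g ∈ Δ, g *ᵥ v = v) ∧ u = fun i => (v i : ℝ)} with hF
  set P : Submodule ℝ (K3Index → ℝ) := Submodule.span ℝ (Set.range ![R, I]) with hP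
  have hPF : P ≤ Submodule.span ℝ F := by
    rw [hP, Submodule.span_le]
    rintro _ ⟨k, rfl⟩
    fin_cases k
    · exact mem_span_latticeFixed_of_forall_mulVec_eq Δ hre
    · exact mem_span_latticeFixed_of_forall_mulVec_eq Δ him
  -- lattice fixed vectors lie in the plane
  have hFfix : ∀ u ∈ F, ∀ g ∈ Δ, (g.map (Int.cast : ℤ → ℝ)) *ᵥ u = u := by
    rintro _ ⟨v, hv, rfl⟩ g hg
    funext i
    have h0 := congrFun (hv g hg) i
    simp only [Matrix.mulVec, dotProduct] at h0
    simp only [Matrix.mulVec, dotProduct, Matrix.map_apply]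
    exact_mod_cast h0
  have hFP : ∀ u ∈ F, u ∈ P := fun u hu => by
    obtain ⟨a, b, hab⟩ := hsub u (hFfix u hu)
    rw [hab, hP]
    exact Submodule.add_mem _ (Submodule.smul_mem _ _ (Submodule.subset_span ⟨0, rfl⟩))
      (Submodule.smul_mem _ _ (Submodule.subset_span ⟨1, rfl⟩))
  have hFP' : Submodule.span ℝ F ≤ P := Submodule.span_le.2 fun u hu => hFP u hu
  have hPeq : Submodule.span ℝ F = P := le_antisymm hFP' hPF
  have hP2 : finrank ℝ P = 2 := finrank_k3Plane hx
  -- two independent lattice vectors in `F`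
  obtain ⟨u, huF, hu0⟩ : ∃ u ∈ F, u ≠ 0 := by
    by_contra hcon
    have hF0 : ∀ u ∈ F, u = 0 := fun u hu => by
      by_contra h; exact hcon ⟨u, hu, h⟩
    have : Submodule.span ℝ F ≤ ⊥ := Submodule.span_le.2 fun u hu => by
      rw [SetLike.mem_coe, Submodule.mem_bot]; exact hF0 u hu
    rw [hPeq, le_bot_iff] at this
    rw [this, finrank_bot] at hP2
    exact two_ne_zero hP2.symm
  obtain ⟨w, hwF, hwu⟩ : ∃ w ∈ F, w ∉ Submodule.span ℝ {u} := by
    by_contra hcon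
    have hFu : Submodule.span ℝ F ≤ Submodule.span ℝ {u} := Submodule.span_le.2 fun w hw => by
      by_contra h; exact hcon ⟨w, hw, h⟩
    rw [hPeq] at hFu
    have := Submodule.finrank_mono hFu
    rw [hP2, finrank_span_singleton hu0] at this
    omega
  -- `span {u, w} = P`
  have huw_le : Submodule.span ℝ {u, w} ≤ P :=
    Submodule.span_le.2 (Set.pair_subset_iff.2 ⟨hFP u huF, hFP w hwF⟩)
  have hind : LinearIndependent ℝ ![u, w] := by
    refine LinearIndependent.pair_iff.2 fun s t hst => ?_
    by_contra hne
    have ht : t ≠ 0 := by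
      intro ht0
      rw [ht0, zero_smul, add_zero] at hst
      rcases smul_eq_zero.1 hst with h | h
      · exact hne ⟨h, ht0⟩
      · exact hu0 h
    apply hwu
    have : w = (-(t⁻¹ * s)) • u := by
      have h1 : t • w = -(s • u) := eq_neg_of_add_eq_zero_right hst
      calc w = t⁻¹ • (t • w) := by rw [smul_smul, inv_mul_cancel₀ ht, one_smul]
        _ = _ := by rw [h1, smul_neg, smul_smul, neg_smul]
    rw [this]
    exact Submodule.smul_mem _ _ (Submodule.subset_span rfl)
  have h2' : finrank ℝ (Submodule.span ℝ ({u, w} : Set (K3Index → ℝ))) = 2 := by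
    have := finrank_span_eq_card hind
    rw [Matrix.range_cons_cons_empty] at this
    simpa using this
  have hspan : Submodule.span ℝ {u, w} = P :=
    Submodule.eq_of_le_of_finrank_eq huw_le (by rw [h2', hP2])
  obtain ⟨vu, hvu, rfl⟩ := huF
  obtain ⟨vw, hvw, rfl⟩ := hwF
  have hRmem : R ∈ Submodule.span ℝ {(fun i => (vu i : ℝ)), (fun i => (vw i : ℝ))} := by
    rw [hspan, hP]; exact Submodule.subset_span ⟨0, rfl⟩
  have hImem : I ∈ Submodule.span ℝ {(fun i => (vu i : ℝ)), (fun i => (vw i : ℝ))} := by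
    rw [hspan, hP]; exact Submodule.subset_span ⟨1, rfl⟩
  obtain ⟨a, b, hab⟩ := Submodule.mem_span_pair.1 hRmem
  obtain ⟨c, d, hcd⟩ := Submodule.mem_span_pair.1 hImem
  refine ⟨vu, vw, a, b, c, d, fun i => ⟨?_, ?_⟩⟩
  · have := congrFun hab i
    simpa [hR] using this.symm
  · have := congrFun hcd i
    simpa [hI] using this.symm

/-- **A non-zero fixed vector in the plane ⇒ a lattice vector in the plane.** Let `x ∈ D` and `Δ` a
family of integer matrices whose common fixed vectors all lie in the plane `P_x` and include some
`s ≠ 0`. Then `P_x` contains a non-zero LATTICE vector fixed by `Δ` (so `x` is not in the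
totally-irrational case (ii) of `Verbitsky2017_orbitClosure_trichotomy_K3`). This is how Borel's
density theorem excludes the Ratner groups `SO(ℓ^⊥)°` (`ℓ ⊂ P_x` a line) and `SO(P_x^⊥)°` for a
plane without rational lines: `Δ = Γ ∩ S` fixes `ℓ` (resp. `P_x`) and its fixed space lies in that
of the unipotents of `S ⊇ H`, i.e. in `P_x`. [folklore] -/
theorem k3_exists_latticeVector_inPlane_of_fixed {x : K3Index → ℂ}
    (Δ : Set (Matrix K3Index K3Index ℤ))
    (hsub : ∀ y : K3Index → ℝ, (∀ g ∈ Δ, (g.map (Int.cast : ℤ → ℝ)) *ᵥ y = y) →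
      ∃ a b : ℝ, y = a • (fun i => (x i).re) + b • (fun i => (x i).im))
    {s : K3Index → ℝ} (hs0 : s ≠ 0) (hs : ∀ g ∈ Δ, (g.map (Int.cast : ℤ → ℝ)) *ᵥ s = s) :
    ∃ v : K3Index → ℤ, v ≠ 0 ∧ (∀ g ∈ Δ, g *ᵥ v = v) ∧
      ∃ a b : ℝ, ∀ i, (v i : ℝ) = a * (x i).re + b * (x i).im := by
  classical
  set F : Set (K3Index → ℝ) :=
    {u | ∃ v : K3Index → ℤ, (∀ g ∈ Δ, g *ᵥ v = v) ∧ u = fun i => (v i : ℝ)} with hF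
  have hsF : s ∈ Submodule.span ℝ F := mem_span_latticeFixed_of_forall_mulVec_eq Δ hs
  obtain ⟨u, huF, hu0⟩ : ∃ u ∈ F, u ≠ 0 := by
    by_contra hcon
    have hF0 : ∀ u ∈ F, u = 0 := fun u hu => by
      by_contra h; exact hcon ⟨u, hu, h⟩
    have : Submodule.span ℝ F ≤ ⊥ := Submodule.span_le.2 fun u hu => by
      rw [SetLike.mem_coe, Submodule.mem_bot]; exact hF0 u hu
    exact hs0 ((Submodule.mem_bot ℝ).1 (this hsF))
  obtain ⟨v, hv, rfl⟩ := huF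
  have hv0 : v ≠ 0 := by
    intro h; apply hu0; funext i; simp [h]
  have hfixR : ∀ g ∈ Δ, (g.map (Int.cast : ℤ → ℝ)) *ᵥ (fun i => (v i : ℝ)) = fun i => (v i : ℝ) := by
    intro g hg
    funext i
    have h0 := congrFun (hv g hg) i
    simp only [Matrix.mulVec, dotProduct] at h0
    simp only [Matrix.mulVec, dotProduct, Matrix.map_apply]
    exact_mod_cast h0
  obtain ⟨a, b, hab⟩ := hsub _ hfixR
  refine ⟨v, hv0, hv, a, b, fun i => ?_⟩
  have := congrFun hab i
  simpa using this

end K3Rational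

end Literature.Dynamics.Homogeneous
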